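import Mathlib.GroupTheory.Index
import Mathlib.Topology.Instances.ZMod
import Mathlib.Topology.Algebra.Constructions
import Literature.AnabelianGeometry.AbsoluteAnabelian.ProfiniteTerminology
import Literature.AnabelianGeometry.SemiGraphs.GraphOfAnabelioids

/-!
# Commensurability properties ([SemiAnbd] §2, Def. 2.3 – Example 2.8, pp. 24–31)

Mochizuki, *Semi-graphs of anabelioids*, Publ. RIMS **42** (2006) 221–322, §2 "Commensurability
Properties", author's manuscript pp. 24–31 [cite: MochizukiSemiAnbd2006, §2 pp.24-31].  Statements
first, over `GraphOfAnabelioids.lean`; every printed claim is a NAMED FACT unless proved: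

* Definition 2.3: (i) bounded order, (ii) (`π₁`-epimorphic) approximators, (iii) quasi-coherent
  ("splits the given collection of coverings"), coherent; Remark 2.3.1;
* Definition 2.4: (i) elevated vertices / totally elevated, (ii) verticially slim, (iv) aloof /
  estranged edges, totally aloof / totally estranged; Remark 2.4.1 first sentence (PROVED);
  Remark 2.4.2 is `MorphismRigidity.lean`;
* Proposition 2.5 (Injectivity) (i), (ii); Remark 2.5.1 (the group-theoretic observation);
* Corollary 2.7 (Slimness and Commensurators) (i), (ii); Remark 2.7.2;
* Example 2.8 (trivial edge anabelioids: quasi-coherence, elevated vertices).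

## Rendering choices (recorded for the referee)

1. Group-theoretic form.  The paper passes freely between finite étale coverings of a connected
   anabelioid and open subgroups of its fundamental group "up to inner automorphism" (p. 22).  We
   state Definition 2.3 (iii), 2.4 (i), (iv) and the results on fundamental groups, for arbitrary
   basepoints (`F : 𝒢_v ⥤ FintypeCat` with `FiberFunctor F`; `Π_𝒢` through a vertex, see
   `GraphOfAnabelioids.lean`): a finite étale covering `ℋ_c → 𝒢_c` of degree `≤ M` of the connected
   anabelioid `𝒢_c` is an open subgroup `U_c ⊆ Π_c` of index `≤ M` (its connected components), and
   "the pull-back to `𝒢_c` of the universal covering of `𝒢'_c` splits `ℋ_c → 𝒢_c`" becomes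
   "`Ker(Π_c → Π'_c) ⊆ U_c`" (the kernel being normal, conjugation is harmless).
2. "Well-defined up to conjugation" (the images `Π_b ⊆ Π_v`) becomes "for every choice of the
   transporting isomorphism of basepoints" (`branchSubgroup … α`); the conditions of Def. 2.4 (i),
   (iv) are invariant under conjugation, so this is equivalent to the printed text.
3. "has infinite index" = `Subgroup.relIndex … = 0`; "order ≥ M" = `M ≤ Nat.card`.
4. Profinite-group terminology (commensurably terminal, relatively slim homomorphisms,
   topologically finitely generated) is the cell's shared `AbsoluteAnabelian/ProfiniteTerminology`.

Deliberately NOT here: Remark 2.4.2 (`MorphismRigidity.lean`); (companion file `Coverticial.lean`, which needs finite étale coverings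
`𝒢' → 𝒢` of Def. 2.2 (i)): Remark 2.2.1, Definition 2.4 (iii) (sub-coverticial edges), Remark 2.4.1,
Proposition 2.6, Remark 2.6.1, Corollary 2.7 (iii), the coverticial half of Example 2.8, Example
2.10 (needs surface groups), Remark 2.10.1, Definition 2.11 and Remark 2.11.1 (generalized
morphisms), Definition 2.9 (`Anabelioids/ProSigma.lean`) and the pro-`Σ` completion of a
semi-graph of anabelioids; the second assertion of Remark
2.5.1 (the graph of anabelioids with trivial `Π_𝒢`, which needs `B(α)` as an exact functor);
Remark 2.7.1 (comparison with [HR]) is prose.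
-/

namespace Literature.AnabelianGeometry.SemiGraphs

open CategoryTheory CategoryTheory.Limits CategoryTheory.PreGaloisCategory
open Literature.AnabelianGeometry.Anabelioids
open Literature.AlgebraicGeometry.Frobenioids (IsSlimGroup)
open scoped Pointwise

universe v₁ u₁ u

namespace SemiGraphOfAnabelioids

variable (𝒢 : SemiGraphOfAnabelioids.{v₁, u₁, u})

/-! ### Definition 2.3 (pp. 24–25) -/

/-- `𝒢` (of injective type) is *of bounded order* if there is an integer `M ≥ 1` such that all the
`π̂₁(𝒢_v)`, `v` a vertex, are finite groups of order dividing `M` ([SemiAnbd] Def. 2.3 (i)), for every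
basepoint. [cite: MochizukiSemiAnbd2006, Def. 2.3(i) p.24] -/
@[mk_iff] structure IsOfBoundedOrder : Prop where
  /-- of injective type (standing assumption of Def. 2.3) -/
  isOfInjectiveType : 𝒢.IsOfInjectiveType
  /-- a common bound `M` for the (finite) orders of the vertex groups -/
  exists_bound : ∃ M : ℕ, 1 ≤ M ∧ ∀ (v : 𝒢.graph.Vertex) (F : 𝒢.V v ⥤ FintypeCat.{v₁})
    [FiberFunctor F], Finite (Aut F) ∧ Nat.card (Aut F) ∣ M

variable {𝒢}

/-- An *approximator* for `𝒢`: a morphism of semi-graphs of anabelioids `𝒢 → 𝒢'` inducing an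
isomorphism on underlying semi-graphs, with `𝒢'` of bounded order ([SemiAnbd] Def. 2.3 (ii)).
[cite: MochizukiSemiAnbd2006, Def. 2.3(ii) pp.24-25] -/
@[mk_iff] structure Hom.IsApproximator {𝒢' : SemiGraphOfAnabelioids.{v₁, u₁, u}} (φ : Hom 𝒢 𝒢') :
    Prop where
  /-- induces an isomorphism `𝔾 ⥲ 𝔾'` of underlying semi-graphs -/
  isIso_base : IsIso φ.base
  /-- the target is of bounded order -/
  isOfBoundedOrder : 𝒢'.IsOfBoundedOrder

/-- A *`π₁`-epimorphic* approximator: each induced morphism between constituent anabelioids is a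
`π₁`-epimorphism ([SemiAnbd] Def. 2.3 (ii)). [cite: MochizukiSemiAnbd2006, Def. 2.3(ii) p.25] -/
@[mk_iff] structure Hom.IsPi1EpiApproximator {𝒢' : SemiGraphOfAnabelioids.{v₁, u₁, u}}
    (φ : Hom 𝒢 𝒢') : Prop where
  /-- it is an approximator -/
  isApproximator : φ.IsApproximator
  /-- every vertex component is a `π₁`-epimorphism -/
  isPi1Epi_V : ∀ v, IsPi1Epi (φ.φV v).pullback
  /-- every edge component is a `π₁`-epimorphism -/
  isPi1Epi_E : ∀ e, IsPi1Epi (φ.φE e (φ.base.edgeMap e) rfl).pullback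

/-- A *collection of finite étale coverings `ℋ_c → 𝒢_c` of degree `≤ M`*, `c` ranging over the
components of `𝔾` ([SemiAnbd] Def. 2.3 (iii)), in group-theoretic form: basepoints of all the
constituents and open subgroups of index `≤ M` (rendering note 1).
[cite: MochizukiSemiAnbd2006, Def. 2.3(iii) p.25] -/
structure CoveringCollection (𝒢 : SemiGraphOfAnabelioids.{v₁, u₁, u}) (M : ℕ) where
  /-- basepoints of the vertex constituents -/
  FV : ∀ v : 𝒢.graph.Vertex, 𝒢.V v ⥤ FintypeCat.{v₁}
  /-- they are fibre functors -/
  fiberV : ∀ v, FiberFunctor (FV v)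
  /-- basepoints of the edge constituents -/
  FE : ∀ e : 𝒢.graph.Edge, 𝒢.E e ⥤ FintypeCat.{v₁}
  /-- they are fibre functors -/
  fiberE : ∀ e, FiberFunctor (FE e)
  /-- the coverings of the vertex constituents, as open subgroups -/
  UV : ∀ v, Subgroup (Aut (FV v))
  /-- the coverings of the edge constituents, as open subgroups -/
  UE : ∀ e, Subgroup (Aut (FE e))
  /-- openness -/
  isOpen_UV : ∀ v, IsOpen (UV v : Set (Aut (FV v)))
  /-- openness -/
  isOpen_UE : ∀ e, IsOpen (UE e : Set (Aut (FE e)))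
  /-- degree `≤ M` -/
  index_UV : ∀ v, (UV v).index ≤ M
  /-- degree `≤ M` -/
  index_UE : ∀ e, (UE e).index ≤ M

/-- The approximator `φ : 𝒢 → 𝒢'` *splits* the collection of coverings: "for each component `c` of
`𝔾`, the pull-back to `𝒢_c` of the “universal covering” `ℋ'_c → 𝒢'_c` of `𝒢'_c` splits `ℋ_c → 𝒢_c`"
([SemiAnbd] Def. 2.3 (iii)), i.e. `Ker(Π_c → Π'_c) ⊆ U_c` (rendering note 1).
[cite: MochizukiSemiAnbd2006, Def. 2.3(iii) p.25] -/
def Hom.Splits {𝒢' : SemiGraphOfAnabelioids.{v₁, u₁, u}} (φ : Hom 𝒢 𝒢') {M : ℕ}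
    (𝒞 : CoveringCollection 𝒢 M) : Prop :=
  (∀ v, (pi1Map (φ.φV v).pullback (𝒞.FV v)).ker ≤ 𝒞.UV v) ∧
    ∀ e, (pi1Map (φ.φE e (φ.base.edgeMap e) rfl).pullback (𝒞.FE e)).ker ≤ 𝒞.UE e

variable (𝒢)

/-- `𝒢` (of injective type) is *quasi-coherent*: for every `M ≥ 1` and every collection of finite
étale coverings `ℋ_c → 𝒢_c` of degree `≤ M` there is an approximator `𝒢 → 𝒢'` splitting it
([SemiAnbd] Def. 2.3 (iii)). [cite: MochizukiSemiAnbd2006, Def. 2.3(iii) p.25] -/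
@[mk_iff] structure IsQuasiCoherent : Prop where
  /-- of injective type (standing assumption of Def. 2.3) -/
  isOfInjectiveType : 𝒢.IsOfInjectiveType
  /-- every bounded collection of coverings is split by some approximator -/
  exists_approximator : ∀ (M : ℕ), 1 ≤ M → ∀ 𝒞 : CoveringCollection 𝒢 M,
    ∃ (𝒢' : SemiGraphOfAnabelioids.{v₁, u₁, u}) (φ : Hom 𝒢 𝒢'), φ.IsApproximator ∧ φ.Splits 𝒞

/-- A quasi-coherent `𝒢` is *coherent* if, for each component `c`, `π̂₁(𝒢_c)` is topologically
finitely generated ([SemiAnbd] Def. 2.3 (iii)). [cite: MochizukiSemiAnbd2006, Def. 2.3(iii) p.25] -/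
@[mk_iff] structure IsCoherent : Prop where
  /-- quasi-coherent -/
  isQuasiCoherent : 𝒢.IsQuasiCoherent
  /-- vertex groups topologically finitely generated -/
  fg_V : ∀ (v : 𝒢.graph.Vertex) (F : 𝒢.V v ⥤ FintypeCat.{v₁}) [FiberFunctor F],
    AbsoluteAnabelian.IsTopologicallyFinitelyGenerated (Aut F)
  /-- edge groups topologically finitely generated -/
  fg_E : ∀ (e : 𝒢.graph.Edge) (F : 𝒢.E e ⥤ FintypeCat.{v₁}) [FiberFunctor F],
    AbsoluteAnabelian.IsTopologicallyFinitelyGenerated (Aut F)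

/-- NAMED FACT, [SemiAnbd] Remark 2.3.1: "by replacing the constituent anabelioids of `𝒢'` by the
image anabelioids …, one may always take the approximator of Definition 2.3, (iii), to be
`π₁`-epimorphic." [cite: MochizukiSemiAnbd2006, Rem. 2.3.1 p.25] -/
def remark_2_3_1 : Prop :=
  ∀ (𝒢 : SemiGraphOfAnabelioids.{v₁, u₁, u}), 𝒢.IsQuasiCoherent → ∀ (M : ℕ), 1 ≤ M →
    ∀ 𝒞 : CoveringCollection 𝒢 M, ∃ (𝒢' : SemiGraphOfAnabelioids.{v₁, u₁, u}) (φ : Hom 𝒢 𝒢'),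
      φ.IsPi1EpiApproximator ∧ φ.Splits 𝒞

/-! ### Definition 2.4 (i), (ii), (iv) (pp. 25–26) -/

/-- A vertex `v` is *elevated* ([SemiAnbd] Def. 2.4 (i)): for every `M ≥ 1` there is a `π₁`-epimorphic
approximator `𝒢 → 𝒢'` and a subgroup `N_M ⊆ π̂₁(𝒢'_v)` of order `≥ M` having trivial intersection with
all conjugates of all the `π̂₁(𝒢'_e) (= Π'_b)`, `e ∋ b` abutting to `v` — for every basepoint of `𝒢'_v`
and every representative of `Π'_b`. [cite: MochizukiSemiAnbd2006, Def. 2.4(i) p.25] -/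
def IsElevated (v : 𝒢.graph.Vertex) : Prop :=
  ∀ M : ℕ, 1 ≤ M → ∃ (𝒢' : SemiGraphOfAnabelioids.{v₁, u₁, u}) (φ : Hom 𝒢 𝒢'),
    φ.IsPi1EpiApproximator ∧
    ∀ (F : 𝒢'.V (φ.base.vertexMap v) ⥤ FintypeCat.{v₁}) [FiberFunctor F],
      ∃ N : Subgroup (Aut F), Finite N ∧ M ≤ Nat.card N ∧
        ∀ (b : 𝒢'.graph.Branch) (h : 𝒢'.graph.abuts b = some (φ.base.vertexMap v))
          (Fe : 𝒢'.E (𝒢'.graph.edgeOf b) ⥤ FintypeCat.{v₁}) [FiberFunctor Fe]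
          (α : (𝒢'.pull b _ h).pullback ⋙ Fe ≅ F)
          (g : Aut F), N ⊓ (ConjAct.toConjAct g • 𝒢'.branchSubgroup F b h Fe α) = ⊥

/-- `𝒢` is *totally elevated* if all of its vertices are elevated ([SemiAnbd] Def. 2.4 (i)).
[cite: MochizukiSemiAnbd2006, Def. 2.4(i) p.25] -/
@[mk_iff] structure IsTotallyElevated : Prop where
  /-- every vertex is elevated -/
  isElevated : ∀ v, 𝒢.IsElevated v

/-- `𝒢` is *verticially slim* if every vertex anabelioid `𝒢_v` is slim ([SemiAnbd] Def. 2.4 (ii)).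
[cite: MochizukiSemiAnbd2006, Def. 2.4(ii) p.25] -/
@[mk_iff] structure IsVerticiallySlim : Prop where
  /-- every `𝒢_v` is slim -/
  isSlim : ∀ v, Anabelioids.IsSlim (𝒢.V v)

/-- The intersection condition of [SemiAnbd] Def. 2.4 (iv) for the edge `e` at strength `P` (a
predicate on the pair `(Π_b, Π_b ∩ g Π_{b'} g⁻¹)`): for every vertex `v` to which some branch `b` of
`e` abuts, every basepoint of `𝒢_v`, every representative `Π_b = Π_b^α` and every `g ∈ Π_v`, the
intersection `Π_b ∩ g Π_{b'} g⁻¹` satisfies `P`, "where either `b' ≠ b` is a branch of an edge that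
abuts to `v`" (first conjunct; any representative of `Π_{b'}`) "or `b' = b` and `g ∉ Π_b`" (second
conjunct, with the SAME representative `Π_b^α` on both sides — print works with one representative;
letting the second transport float in the `b' = b` case makes the condition degenerate, RQ7 finding
of L3-t12, ruling Ϡ); the representatives `Π_b^{F_e,α}` are taken at BASEPOINTS `F_e` (fibre functors)
only, as in print (finding F-L3t11-1). [cite: MochizukiSemiAnbd2006, Def. 2.4(iv) p.26] -/
def EdgeIntersectionCondition (e : 𝒢.graph.Edge)
    (P : ∀ {Γ : Type (max u₁ v₁)} [Group Γ], Subgroup Γ → Subgroup Γ → Prop) : Prop :=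
  ∀ (b : 𝒢.graph.Branch) (_ : 𝒢.graph.edgeOf b = e) (v : 𝒢.graph.Vertex) (h : 𝒢.graph.abuts b = some v)
    (F : 𝒢.V v ⥤ FintypeCat.{v₁}) [FiberFunctor F]
    (Fe : 𝒢.E (𝒢.graph.edgeOf b) ⥤ FintypeCat.{v₁}) [FiberFunctor Fe]
    (α : (𝒢.pull b v h).pullback ⋙ Fe ≅ F),
    (∀ (b' : 𝒢.graph.Branch) (h' : 𝒢.graph.abuts b' = some v)
        (Fe' : 𝒢.E (𝒢.graph.edgeOf b') ⥤ FintypeCat.{v₁}) [FiberFunctor Fe']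
        (α' : (𝒢.pull b' v h').pullback ⋙ Fe' ≅ F) (g : Aut F), b' ≠ b →
        P (𝒢.branchSubgroup F b h Fe α)
          (𝒢.branchSubgroup F b h Fe α ⊓ (ConjAct.toConjAct g • 𝒢.branchSubgroup F b' h' Fe' α'))) ∧
      ∀ (g : Aut F), g ∉ 𝒢.branchSubgroup F b h Fe α →
        P (𝒢.branchSubgroup F b h Fe α)
          (𝒢.branchSubgroup F b h Fe α ⊓ (ConjAct.toConjAct g • 𝒢.branchSubgroup F b h Fe α))

/-- An edge `e` is *aloof*: the intersections of Def. 2.4 (iv) have infinite index in `Π_b`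
([SemiAnbd] Def. 2.4 (iv)). [cite: MochizukiSemiAnbd2006, Def. 2.4(iv) p.26] -/
def IsAloof (e : 𝒢.graph.Edge) : Prop :=
  𝒢.EdgeIntersectionCondition e (fun B I => I.relIndex B = 0)

/-- An edge `e` is *estranged*: the intersections of Def. 2.4 (iv) have infinite index in `Π_b`
"and [are], in fact, trivial" ([SemiAnbd] Def. 2.4 (iv), read as appending the triviality to the
infinite-index condition, as Remark 2.4.1 "estranged implies aloof" confirms).
[cite: MochizukiSemiAnbd2006, Def. 2.4(iv) p.26] -/
def IsEstranged (e : 𝒢.graph.Edge) : Prop :=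
  𝒢.EdgeIntersectionCondition e (fun B I => I.relIndex B = 0 ∧ I = ⊥)

/-- `𝒢` is *totally aloof* if every edge is aloof ([SemiAnbd] Def. 2.4 (iv)).
[cite: MochizukiSemiAnbd2006, Def. 2.4(iv) p.26] -/
@[mk_iff] structure IsTotallyAloof : Prop where
  /-- every edge is aloof -/
  isAloof : ∀ e, 𝒢.IsAloof e

/-- `𝒢` is *totally estranged* if every edge is estranged ([SemiAnbd] Def. 2.4 (iv)).
[cite: MochizukiSemiAnbd2006, Def. 2.4(iv) p.26] -/
@[mk_iff] structure IsTotallyEstranged : Prop where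
  /-- every edge is estranged -/
  isEstranged : ∀ e, 𝒢.IsEstranged e

/-- [SemiAnbd] Remark 2.4.1, first sentence: "It is immediate that “(totally) estranged” implies
“(totally) aloof”" — PROVED (with the printed reading of "estranged": infinite index *and* trivial).
[cite: MochizukiSemiAnbd2006, Rem. 2.4.1 p.26] -/
theorem IsEstranged.isAloof {e : 𝒢.graph.Edge} (h : 𝒢.IsEstranged e) : 𝒢.IsAloof e :=
  fun b hb v hv F _ Fe _ α =>
    ⟨fun b' h' Fe' _ α' g hg => ((h b hb v hv F Fe α).1 b' h' Fe' α' g hg).1,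
      fun g hg => ((h b hb v hv F Fe α).2 g hg).1⟩

/-- Totally estranged semi-graphs of anabelioids are totally aloof ([SemiAnbd] Remark 2.4.1).
[cite: MochizukiSemiAnbd2006, Rem. 2.4.1 p.26] -/
theorem IsTotallyEstranged.isTotallyAloof (h : 𝒢.IsTotallyEstranged) : 𝒢.IsTotallyAloof :=
  ⟨fun e => (h.isEstranged e).isAloof⟩

variable {𝒢}

/-! ### Proposition 2.5 (Injectivity) and Remark 2.5.1 (pp. 27–28) -/

/-- NAMED FACT, [SemiAnbd] Proposition 2.5 (i) (Injectivity): for a connected, quasi-coherent graph of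
anabelioids `𝒢` and a connected subgraph `ℍ ⊆ 𝔾`, "the natural morphisms `Π_b → Π_𝒢`, `Π_v → Π_𝒢`,
`Π_ℍ → Π_𝒢` are injective" (for the basepoints through the vertex in question; `Π_ℍ` is taken
through a vertex of `ℍ`, so vertexless edge-only connected subgraphs, for which the print's `Π_ℍ` is
also defined, are not covered by the third clause; `ℍ` is a sub-GRAPH — every branch abuts —
as in print, ruling δ2). [cite: MochizukiSemiAnbd2006, Prop. 2.5(i) p.27] -/
def proposition_2_5_i : Prop :=
  ∀ (𝒢 : SemiGraphOfAnabelioids.{v₁, u₁, u}), 𝒢.IsConnected → 𝒢.IsGraphOfAnabelioids →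
    𝒢.IsQuasiCoherent →
    (∀ (b : 𝒢.graph.Branch) (v : 𝒢.graph.Vertex) (h : 𝒢.graph.abuts b = some v)
        (F : 𝒢.E (𝒢.graph.edgeOf b) ⥤ FintypeCat.{v₁}) [FiberFunctor F],
        Function.Injective (𝒢.piBToPi b v h F)) ∧
      (∀ (v : 𝒢.graph.Vertex) (F : 𝒢.V v ⥤ FintypeCat.{v₁}) [FiberFunctor F],
        Function.Injective (𝒢.piVToPi v F)) ∧
      ∀ (H : 𝒢.graph.Subgraph), H.toSemiGraph.IsConnected → H.toSemiGraph.IsGraph →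
        ∀ (w : H.toSemiGraph.Vertex) (F : 𝒢.V w.1 ⥤ FintypeCat.{v₁}) [FiberFunctor F],
          Function.Injective (𝒢.piHToPi H w F)

/-- NAMED FACT, [SemiAnbd] Proposition 2.5 (ii): if moreover `𝒢` is of bounded order, "there exists a
normal open subgroup `H ⊆ Π_𝒢` such that all of the natural morphisms `Π_b → Π_𝒢/H`, `Π_v → Π_𝒢/H` are
injective" — `Π_𝒢` for the basepoint through a fixed vertex `v₀`, the other `Π_v`, `Π_b` being mapped
in along any isomorphism of basepoints. [cite: MochizukiSemiAnbd2006, Prop. 2.5(ii) p.27] -/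
def proposition_2_5_ii : Prop :=
  ∀ (𝒢 : SemiGraphOfAnabelioids.{v₁, u₁, u}), 𝒢.IsConnected → 𝒢.IsGraphOfAnabelioids →
    𝒢.IsQuasiCoherent → 𝒢.IsOfBoundedOrder →
    ∀ (v₀ : 𝒢.graph.Vertex) (F₀ : 𝒢.V v₀ ⥤ FintypeCat.{v₁}) [FiberFunctor F₀],
      ∃ (N : Subgroup (𝒢.Pi v₀ F₀)) (_ : N.Normal), IsOpen (N : Set (𝒢.Pi v₀ F₀)) ∧
        (∀ (v : 𝒢.graph.Vertex) (F : 𝒢.V v ⥤ FintypeCat.{v₁}) [FiberFunctor F]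
            (α : 𝒢.ρ v ⋙ F ≅ 𝒢.ρ v₀ ⋙ F₀),
            Function.Injective ((QuotientGroup.mk' N).comp
              ((Aut.autMulEquivOfIso α).toMonoidHom.comp (𝒢.piVToPi v F)))) ∧
        ∀ (b : 𝒢.graph.Branch) (v : 𝒢.graph.Vertex) (h : 𝒢.graph.abuts b = some v)
          (F : 𝒢.E (𝒢.graph.edgeOf b) ⥤ FintypeCat.{v₁}) [FiberFunctor F]
          (α : 𝒢.ρ v ⋙ ((𝒢.pull b v h).pullback ⋙ F) ≅ 𝒢.ρ v₀ ⋙ F₀),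
          Function.Injective ((QuotientGroup.mk' N).comp
            ((Aut.autMulEquivOfIso α).toMonoidHom.comp (𝒢.piBToPi b v h F)))

end SemiGraphOfAnabelioids

/-- The shift `α : G^ℕ ↪ G^ℕ` "induced by the injection `ℕ ↪ ℕ`, `n ↦ n + 1`" of [SemiAnbd] Remark
2.5.1: `(α x)_{n+1} = x_n`, `(α x)_0 = 1`. [cite: MochizukiSemiAnbd2006, Rem. 2.5.1 p.27] -/
def shiftHom (G : Type*) [Group G] : (ℕ → G) →* (ℕ → G) where
  toFun x n := Nat.casesOn n 1 fun m => x m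
  map_one' := by funext n; cases n <;> rfl
  map_mul' x y := by funext n; cases n <;> simp

/-- NAMED FACT, [SemiAnbd] Remark 2.5.1 (the group-theoretic observation): for `G = ℤ/lℤ`, `l` prime,
and `G^ℕ` with the product (profinite) topology, "there does not exist a proper open subgroup
`H ⊆ G^ℕ` such that `H = α⁻¹(H)`". [cite: MochizukiSemiAnbd2006, Rem. 2.5.1 p.27] -/
def remark_2_5_1 : Prop :=
  ∀ (l : ℕ) [Fact l.Prime] (H : Subgroup (ℕ → Multiplicative (ZMod l))),
    IsOpen (H : Set (ℕ → Multiplicative (ZMod l))) →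
      H.comap (shiftHom (Multiplicative (ZMod l))) = H → H = ⊤

namespace SemiGraphOfAnabelioids

/-! ### Corollary 2.7 (Slimness and Commensurators) (i), (ii); Remark 2.7.2 (p. 30) -/

/-- NAMED FACT, [SemiAnbd] Corollary 2.7 (i): `𝒢` a connected, quasi-coherent graph of anabelioids,
`ℍ ⊆ 𝔾` a connected subgraph (a GRAPH: every branch of `ℍ` abuts, ruling δ2) all of whose vertices
are elevated; "We have `C_{Π_𝒢}(Π_ℍ) = Π_ℍ`.  In
particular, if `v` is an elevated vertex of `𝒢`, then `C_{Π_𝒢}(Π_v) = Π_v`."  (`Π_ℍ` through a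
vertex of `ℍ`; here `ℍ` has a vertex by hypothesis.) [cite: MochizukiSemiAnbd2006, Cor. 2.7(i) p.30] -/
def corollary_2_7_i : Prop :=
  ∀ (𝒢 : SemiGraphOfAnabelioids.{v₁, u₁, u}), 𝒢.IsConnected → 𝒢.IsGraphOfAnabelioids →
    𝒢.IsQuasiCoherent →
    (∀ (H : 𝒢.graph.Subgraph), H.toSemiGraph.IsConnected → H.toSemiGraph.IsGraph →
      (∀ w : H.toSemiGraph.Vertex, 𝒢.IsElevated w.1) →
      ∀ (w : H.toSemiGraph.Vertex) (F : 𝒢.V w.1 ⥤ FintypeCat.{v₁})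
        [FiberFunctor F], AbsoluteAnabelian.IsCommensurablyTerminal (𝒢.piHToPi H w F).range) ∧
    ∀ (v : 𝒢.graph.Vertex), 𝒢.IsElevated v → ∀ (F : 𝒢.V v ⥤ FintypeCat.{v₁}) [FiberFunctor F],
      AbsoluteAnabelian.IsCommensurablyTerminal (𝒢.piVToPi v F).range

/-- NAMED FACT, [SemiAnbd] Corollary 2.7 (ii): with `𝒢`, `ℍ` as in (i), "suppose that `ℍ` contains a
vertex `v` such that `𝒢_v` is slim.  Then the natural morphism `B(𝒢_ℍ) → B(𝒢)` is relatively slim.  In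
particular, `B(𝒢)` is slim" — on fundamental groups for the basepoints through `v`.
[cite: MochizukiSemiAnbd2006, Cor. 2.7(ii) p.30] -/
def corollary_2_7_ii : Prop :=
  ∀ (𝒢 : SemiGraphOfAnabelioids.{v₁, u₁, u}), 𝒢.IsConnected → 𝒢.IsGraphOfAnabelioids →
    𝒢.IsQuasiCoherent → ∀ (H : 𝒢.graph.Subgraph), H.toSemiGraph.IsConnected →
    H.toSemiGraph.IsGraph → (∀ w : H.toSemiGraph.Vertex, 𝒢.IsElevated w.1) →
    ∀ (w : H.toSemiGraph.Vertex), Anabelioids.IsSlim (𝒢.V w.1) →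
      ∀ (F : 𝒢.V w.1 ⥤ FintypeCat.{v₁}) [FiberFunctor F],
        AbsoluteAnabelian.IsRelativelySlim (𝒢.piHToPi H w F) ∧ IsSlimGroup (𝒢.Pi w.1 F)

/-- NAMED FACT, [SemiAnbd] Remark 2.7.2: Corollary 2.7 (i) implies that "if `J ⊆ Π_𝒢` is any [not
necessarily closed!] subgroup such that `Π_v ⊆ J`, then `C_J(Π_v) ⊆ C_{Π_𝒢}(Π_v) = Π_v` — i.e., `Π_v` is
commensurably terminal in `J`" (hypotheses as in Corollary 2.7 (i), `v` elevated).
[cite: MochizukiSemiAnbd2006, Rem. 2.7.2 p.30] -/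
def remark_2_7_2 : Prop :=
  ∀ (𝒢 : SemiGraphOfAnabelioids.{v₁, u₁, u}), 𝒢.IsConnected → 𝒢.IsGraphOfAnabelioids →
    𝒢.IsQuasiCoherent → ∀ (v : 𝒢.graph.Vertex), 𝒢.IsElevated v →
    ∀ (F : 𝒢.V v ⥤ FintypeCat.{v₁}) [FiberFunctor F] (J : Subgroup (𝒢.Pi v F)),
      (𝒢.piVToPi v F).range ≤ J →
        AbsoluteAnabelian.IsCommensurablyTerminal (((𝒢.piVToPi v F).range).subgroupOf J)

/-! ### Example 2.8 (trivial edge anabelioids), first half (p. 31) -/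

variable (𝒢 : SemiGraphOfAnabelioids.{v₁, u₁, u})

/-- All edge anabelioids of `𝒢` are *trivial*: their fundamental groups are trivial ([SemiAnbd]
Example 2.8 "`𝒢_e` is trivial for all edges `e`"). [cite: MochizukiSemiAnbd2006, Ex. 2.8 p.31] -/
@[mk_iff] structure HasTrivialEdgeAnabelioids : Prop where
  /-- `π̂₁(𝒢_e) = 1` for every edge and basepoint -/
  subsingleton : ∀ (e : 𝒢.graph.Edge) (F : 𝒢.E e ⥤ FintypeCat.{v₁}) [FiberFunctor F],
    Subsingleton (Aut F)

/-- NAMED FACT, [SemiAnbd] Example 2.8, first two assertions: "every semi-graph of anabelioids `𝒢`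
such that `𝒢_e` is trivial for all edges `e` is quasi-coherent.  In this case, a vertex `v` of `𝒢` is
elevated if and only if `Π_v` is infinite." [cite: MochizukiSemiAnbd2006, Ex. 2.8 p.31] -/
def example_2_8_quasiCoherent_elevated : Prop :=
  ∀ (𝒢 : SemiGraphOfAnabelioids.{v₁, u₁, u}), 𝒢.HasTrivialEdgeAnabelioids →
    𝒢.IsQuasiCoherent ∧ ∀ (v : 𝒢.graph.Vertex),
      𝒢.IsElevated v ↔ ∀ (F : 𝒢.V v ⥤ FintypeCat.{v₁}) [FiberFunctor F], Infinite (Aut F)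

end SemiGraphOfAnabelioids


end Literature.AnabelianGeometry.SemiGraphs
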